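import Mathlib
import Literature.AlgebraicGeometry.Resolution.CobordantGame
import Summits.ResolutionOfSingularities.ResolutionOfSingularities.Theses.WeightedInvariant
import Summits.ResolutionOfSingularities.ResolutionOfSingularities.Theorems.WeightedInvariantGlobalizeLocalDropCanonize
import Summits.ResolutionOfSingularities.ResolutionOfSingularities.Theorems.WeightedInvariantGlobalizeLocalDropCylinder
import Summits.ResolutionOfSingularities.ResolutionOfSingularities.Theorems.WeightedInvariantGlobalizeLocalDropRegularGerms

/-!
# `WeightedInvariant.GlobalizeLocalDrop`: logical position, and (H1)–(H3) of `stub_hornedRank`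
# for the canonical rank

Route `ResolutionOfSingularities/WeightedInvariant`, support item `GlobalizeLocalDrop`
(stmt-ResolutionOfSingularities-14763): `LocalWeightedDrop → WeightedConstruction`.  Packaging file over
the three sibling files `…GlobalizeLocalDropCanonize` (step (1): `leastRank` canonical, unit- and
coordinate-invariant), `…GlobalizeLocalDropCylinder` (cylinder monotonicity at won germs) and
`…GlobalizeLocalDropRegularGerms` (value `0` off the singular germs):

* `globalizeLocalDrop_iff_not_or`, `globalizeLocalDrop_iff_of_localWeightedDrop` — LOGICAL POSITION of
  the item: it holds iff the crux `LocalWeightedDrop` (stmt-8899) fails or the crux `WeightedConstruction`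
  (stmt-0571) holds, and it IS `WeightedConstruction` once `LocalWeightedDrop` is proved.  (Steps (2) EXTEND
  and (3) GLOBALIZE of the item's sketch are open mathematics; see the item's evidence note.)
* `won_of_localWeightedDrop` — under the crux every germ in `n ≥ 1` variables is won.
* `leastRank_cyl_le_of_allSingularWon` — (H3) per field: if every singular germ over `k` is won, the
  canonical rank does not increase along cylinders, for all `n` and all germs.
* `leastRank_hornedRank_H123_of_localWeightedDrop` — under the crux, over an algebraically closed field
  of characteristic `p`, `ρ := CobordantGame.leastRank` satisfies VERBATIM the first three conjuncts
  (H1) coordinate changes, (H2) units, (H3) cylinders of the first 8899 line lead's `stub_hornedRank`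
  (crux workfile `Cruxes/LocalWeightedDrop/Lines/vertex-descent-weight-residues.lean`) — everything that
  stub asks of `ρ` except its drop clause (H4), which is the crux itself in tame/wild normal form.
  (H1)/(H2) are unconditional equalities (`leastRank_subst`, `leastRank_unit_mul`).
-/

set_option linter.dupNamespace false -- mandated namespace of this single-conjunct summit

namespace Summit.ResolutionOfSingularities.ResolutionOfSingularities.Theorems

open Literature.AlgebraicGeometry.Resolution
open Literature.AlgebraicGeometry.Resolution.CobordantGame
open Summit.ResolutionOfSingularities.ResolutionOfSingularities.Theses.WeightedInvariant

/-! ### 1. Logical position of the item -/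

/-- LOGICAL POSITION: `GlobalizeLocalDrop` holds iff the crux `LocalWeightedDrop` (its antecedent,
stmt-8899) fails or the crux `WeightedConstruction` (its consequent, stmt-0571) holds — either
settlement currently attempted on the route gives the item for free. -/
theorem globalizeLocalDrop_iff_not_or : GlobalizeLocalDrop ↔ (¬ LocalWeightedDrop ∨ WeightedConstruction) := by
  unfold GlobalizeLocalDrop
  tauto

/-- Once `LocalWeightedDrop` is proved, `GlobalizeLocalDrop` IS the crux `WeightedConstruction`. -/
theorem globalizeLocalDrop_iff_of_localWeightedDrop (h : LocalWeightedDrop) :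
    GlobalizeLocalDrop ↔ WeightedConstruction :=
  ⟨fun hG => hG h, fun hW _ => hW⟩

/-! ### 2. Every germ is won under the crux; (H3) per field -/

variable {k : Type} [Field k]

/-- Under `LocalWeightedDrop`, over an algebraically closed field of characteristic `p`, EVERY germ in
`n ≥ 1` variables is in the winning region (singular ones by the crux, the others in one move), so
`leastRank` is the honest game value everywhere. -/
theorem won_of_localWeightedDrop (hL : LocalWeightedDrop) {p : ℕ} (hp : p.Prime) (k : Type) [Field k]
    [CharP k p] [IsAlgClosed k] {n : ℕ} (hn : 0 < n) (f : MvPowerSeries (Fin n) k) : Won k n f :=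
  won_of_allSingularWon (localWeightedDrop_iff_allWon.mp hL p hp k) hn f

/-- (H3) PER FIELD: over a field where every singular germ is won, the canonical rank does not increase
along cylinders, for ALL `n` and all germs (no characteristic hypothesis). -/
theorem leastRank_cyl_le_of_allSingularWon
    (hW : ∀ (n : ℕ) (f : MvPowerSeries (Fin n) k), IsSingular k f → Won k n f)
    (n : ℕ) (j : Fin (n + 1)) (h : MvPowerSeries (Fin n) k) :
    leastRank (n + 1) (MvPowerSeries.subst
      (fun m : Fin n => (MvPowerSeries.X (j.succAbove m) : MvPowerSeries (Fin (n + 1)) k)) h) ≤ leastRank n h := by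
  rcases Nat.eq_zero_or_pos n with rfl | hn
  · exact (leastRank_cyl_fin_zero j h).trans_le zero_le
  · exact leastRank_cyl_le j (won_of_allSingularWon hW hn h)

/-! ### 3. (H1)–(H3) of `stub_hornedRank` for the canonical rank -/

/-- (H1)–(H3) OF `stub_hornedRank` FOR THE CANONICAL RANK.  Under `LocalWeightedDrop`, over an algebraically
closed field of characteristic `p`, `ρ := CobordantGame.leastRank` is (H1) monotone (indeed invariant) under formal
coordinate changes, (H2) monotone (invariant) under units, (H3) monotone under cylinders along every slot — the
three structural conjuncts of the first line lead's `stub_hornedRank` (crux stmt-8899), verbatim with `ρ := leastRank`.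
(H1)/(H2) hold unconditionally (`leastRank_subst`, `leastRank_unit_mul`); (H3) uses the crux only through "every
singular germ is won" (`leastRank_cyl_le_of_allSingularWon`, per field, characteristic-free). -/
theorem leastRank_hornedRank_H123_of_localWeightedDrop (hL : LocalWeightedDrop) {p : ℕ} (hp : p.Prime)
    (k : Type) [Field k] [CharP k p] [IsAlgClosed k] :
    (∀ (n : ℕ) (f : MvPowerSeries (Fin n) k) (Φ : Fin n → MvPowerSeries (Fin n) k),
      (∀ i, MvPowerSeries.constantCoeff (Φ i) = 0) →
      IsUnit (Matrix.det (Matrix.of fun i j => MvPowerSeries.coeff (Finsupp.single j 1) (Φ i))) →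
      leastRank n (MvPowerSeries.subst Φ f) ≤ leastRank n f) ∧
    (∀ (n : ℕ) (f u : MvPowerSeries (Fin n) k), MvPowerSeries.constantCoeff u ≠ 0 →
      leastRank n (u * f) ≤ leastRank n f) ∧
    (∀ (n : ℕ) (j : Fin (n + 1)) (h : MvPowerSeries (Fin n) k),
      leastRank (n + 1) (MvPowerSeries.subst
        (fun m : Fin n => (MvPowerSeries.X (j.succAbove m) : MvPowerSeries (Fin (n + 1)) k)) h) ≤ leastRank n h) :=
  ⟨fun _ f _ hΦ0 hdet => (leastRank_subst hΦ0 hdet f).le, fun _ f _ hu => (leastRank_unit_mul hu f).le,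
    leastRank_cyl_le_of_allSingularWon (localWeightedDrop_iff_allWon.mp hL p hp k)⟩

end Summit.ResolutionOfSingularities.ResolutionOfSingularities.Theorems
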